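import Summits.CriticalPhenomena.SAWScalingLimit.Theorems.SAWRenewalTightnessConfinementPositivitySlabOfChainLemmas
import Summits.CriticalPhenomena.SAWScalingLimit.Theorems.SAWRenewalTightnessStripMassConservation
import Literature.Probability.RandomPlanarGeometry.SAWWordBridges
import Literature.Probability.RandomPlanarGeometry.SAWCount
import HarnessLib

/-!
# Crux `ConfinementPositivity` (stmt-CriticalPhenomena-17587), line `Sketch` (card `sign-universality`),
# stub B′p0 `stub_slabOfChain`: chain currency ⇒ slab-walk currency

The line's registered stub `stub_slabOfChain : ChainPinnedTube → SlabTubeConfinement` compares two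
presentations of the same finite family of critical self-avoiding walks.

* *Slab walks* (the conclusion `SlabTubeConfinement`): vertex functions `ω ∈ Zd.sawFun 2 n (L, y₁ - y₀)`
  (`SAWCount.lean`) staying in the slab `0 ≤ x ≤ L` and the tube `|y₀ + y| ≤ X`, weighted `x_c ^ n`,
  summed over `n ≤ N`.
* *Kesten chains* (the hypothesis `ChainPinnedTube`): lists `l` of irreducible bridge words
  (`IsIrrBridge`, `SAWWordBridges.lean`) of total span `L + 1` whose concatenation `l.flatten`, started
  at height `y₀`, ends at height `y₁` and stays in the tube, weighted `x_c ^ (total length)` (`tsum` in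
  `ℝ≥0∞`).

## Proof (the word-level lemmas are in `…ConfinementPositivitySlabOfChainLemmas.lean`, `SlabOfChain.*`)

1. `SlabOfChain.cons_wordOf_spec` / `SlabOfChain.tail_spec`: `ω ↦ E :: wordOf n ω` (prepend one east
   step to the step word of `ω`, `SAWWords.lean`) is a bijection from the slab walks of length `n` onto
   the self-avoiding BRIDGE words `b` of length `n + 1` and span `L + 1` with `wEnd b 1 = y₁ - y₀`; it
   transports the tube condition (`traj b (i+1) = e₀ + ω i`; the extra vertex is the origin, in the tube
   as `|y₀| ≤ X`). Hence the slab sum is a sum over a finite set of bridge words (`slab_sum_eq`).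
2. Kesten's factorisation (Kesten 1963, §4; Madras–Slade 1993, §4.2): every self-avoiding bridge word is
   uniquely the concatenation of irreducible bridge words (`SlabOfChain.exists_chain_eq_flatten`,
   `slabOfChain_flatten_injective`, from the tree's `StripMass.exists_irrBridge_append` and unique
   decoding `eq_of_append_eq'`). Spans and lengths add, so `l ↦ l.flatten` identifies the chain `tsum`
   with the same finite sum of bridge words, with weight `x_c ^ |b|` (`chain_tsum_eq`).
3. Finiteness (`SlabOfChain.length_lt_of_tube`): a self-avoiding word in the box
   `[0, L+1] × [-X-y₀, X-y₀]` has fewer than `(L+2)(2X+1)` steps, so for `N + 2 ≥ (L+2)(2X+1)` the slab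
   partial sum is the full mass and `chain mass = ofReal (x_c · slab sum)` (`chain_eq_ofReal_slab`).
4. Assembly (`stub_slabOfChain`): with `c` from the hypothesis and `N' = N + (L+2)(2V+1)`,
   `c · slab_V(N) ≤ c · slab_V(N') = x_c⁻¹ (c · chain_V) ≤ x_c⁻¹ chain_W = slab_W(N')`.

Elementary; sources: H. Kesten, *On the number of self-avoiding walks*, J. Math. Phys. 4 (1963), §4;
N. Madras, G. Slade, *The Self-Avoiding Walk* (1993), §1.1, §4.2. No `def`s, no new named facts.
-/

noncomputable section
open scoped BigOperators ENNReal
open Literature.Probability.LatticeModels Literature.Probability.RandomPlanarGeometry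
  Literature.Probability.RandomPlanarGeometry.SAW

namespace Summit.CriticalPhenomena.SAWScalingLimit.Theorems

open Classical

namespace SlabOfChain

/-! ### The finite set of tube bridge words; the two sums as sums over it -/

/-- Membership in the finite set of self-avoiding bridge words of length `≤ N + 1`, span `L + 1`,
end height `y₁ - y₀`, in the tube `|y₀ + y| ≤ X`. [folklore] -/
theorem mem_tubeWords {N L X : ℕ} {y₀ y₁ : ℤ} {b : List Step} :
    b ∈ ((Finset.range (N + 2)).biUnion sawWords).filter (fun b => IsBridgeW b ∧
        xEnd b = (L : ℤ) + 1 ∧ wEnd b 1 = y₁ - y₀ ∧ ∀ i, |y₀ + traj b i 1| ≤ (X : ℤ)) ↔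
      b.length ≤ N + 1 ∧ IsSAW b ∧ IsBridgeW b ∧ xEnd b = (L : ℤ) + 1 ∧ wEnd b 1 = y₁ - y₀ ∧
        ∀ i, |y₀ + traj b i 1| ≤ (X : ℤ) := by
  rw [Finset.mem_filter, Finset.mem_biUnion]
  constructor
  · rintro ⟨⟨n, hn, hb⟩, h⟩
    rw [Finset.mem_range] at hn
    rw [mem_sawWords] at hb
    exact ⟨by omega, hb.2, h⟩
  · rintro ⟨hl, hs, h⟩
    exact ⟨⟨b.length, Finset.mem_range.2 (by omega), mem_sawWords.2 ⟨rfl, hs⟩⟩, h⟩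

/-- **Slab sum = word sum.** For `|y₀| ≤ X`, the partial `x_c`-mass (lengths `≤ N`) of slab walks
`(0, y₀) → (L, y₁)` in the tube `|y| ≤ X` equals the sum of `x_c ^ (|b| - 1)` over the tube bridge
words `b` of length `≤ N + 1` (bijection `ω ↦ E :: wordOf n ω`, inverse `b ↦ traj b.tail`).
[cite: MadrasSlade1993, §1.1] -/
theorem slab_sum_eq (L X : ℕ) (y₀ y₁ : ℤ) (hy₀ : |y₀| ≤ (X : ℤ)) (N : ℕ) :
    (∑ n ∈ Finset.range (N + 1), ∑ _ω ∈ (Zd.sawFun 2 n ![(L : ℤ), y₁ - y₀]).filter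
        (fun ω => ∀ i ≤ n, (0 : ℤ) ≤ ω i 0 ∧ ω i 0 ≤ (L : ℤ) ∧ |y₀ + ω i 1| ≤ (X : ℤ)),
        criticalFugacity ^ n) =
      ∑ b ∈ ((Finset.range (N + 2)).biUnion sawWords).filter (fun b => IsBridgeW b ∧
          xEnd b = (L : ℤ) + 1 ∧ wEnd b 1 = y₁ - y₀ ∧ ∀ i, |y₀ + traj b i 1| ≤ (X : ℤ)),
        criticalFugacity ^ (b.length - 1) := by
  rw [Finset.sum_sigma']
  refine Finset.sum_nbij' (fun p => (0 : Step) :: wordOf p.1 p.2)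
    (fun b => (⟨b.length - 1, traj b.tail⟩ : Σ _ : ℕ, ℕ → Site 2)) ?_ ?_ ?_ ?_ ?_
  · rintro ⟨n, ω⟩ hp
    simp only [Finset.mem_sigma, Finset.mem_range, Finset.mem_filter] at hp
    obtain ⟨hn, hω, hslab⟩ := hp
    obtain ⟨hs, hb, hx, hw, ht⟩ := cons_wordOf_spec hω hy₀ hslab
    exact mem_tubeWords.2 ⟨by simp only [List.length_cons, length_wordOf]; omega, hs, hb, hx, hw, ht⟩
  · intro b hb
    obtain ⟨hl, hs, hbr, hx, hw, ht⟩ := mem_tubeWords.1 hb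
    obtain ⟨-, hmem, hslab, -⟩ := tail_spec hs hbr hx hw ht
    simp only [Finset.mem_sigma, Finset.mem_range, Finset.mem_filter]
    exact ⟨by omega, hmem, hslab⟩
  · rintro ⟨n, ω⟩ hp
    simp only [Finset.mem_sigma, Finset.mem_range, Finset.mem_filter] at hp
    have hsaws : ω ∈ Zd.saws 2 n := (Zd.mem_sawFun_iff_mem_saws.1 hp.2.1).1
    exact Sigma.ext (by simp) (heq_of_eq (by simp [traj_wordOf hsaws]))
  · intro b hb
    obtain ⟨hl, hs, hbr, hx, hw, ht⟩ := mem_tubeWords.1 hb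
    obtain ⟨h1, -, -, h4⟩ := tail_spec hs hbr hx hw ht
    show (0 : Step) :: wordOf (b.length - 1) (traj b.tail) = b
    rw [h4]
    exact h1.symm
  · rintro ⟨n, ω⟩ -
    simp

/-- **Chain sum = word sum.** For `N + 2 ≥ (L + 2)(2X + 1)`, the `x_c`-mass of the Kesten chains of
total span `L + 1` whose concatenation, started at height `y₀`, ends at height `y₁` and stays in the
tube `|y| ≤ X` equals the sum of `x_c ^ |b|` over the tube bridge words of length `≤ N + 1`
(bijection `l ↦ l.flatten`: Kesten's unique factorisation; all tube words are that short).
[cite: Kesten1963SAW, §4] -/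
theorem chain_tsum_eq (L X : ℕ) (y₀ y₁ : ℤ) (N : ℕ) (hN : (L + 2) * (2 * X + 1) ≤ N + 2) :
    (∑' l : {l : List (List Step) // (∀ w ∈ l, IsIrrBridge w) ∧
        (l.map xEnd).sum = ((L + 1 : ℕ) : ℤ) ∧
        (y₀ + wEnd l.flatten 1 = y₁ ∧ ∀ i, |y₀ + traj l.flatten i 1| ≤ (X : ℤ))},
      ENNReal.ofReal (criticalFugacity ^ (l.1.map List.length).sum)) =
      ∑ b ∈ ((Finset.range (N + 2)).biUnion sawWords).filter (fun b => IsBridgeW b ∧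
          xEnd b = (L : ℤ) + 1 ∧ wEnd b 1 = y₁ - y₀ ∧ ∀ i, |y₀ + traj b i 1| ≤ (X : ℤ)),
        ENNReal.ofReal (criticalFugacity ^ b.length) := by
  set T := ((Finset.range (N + 2)).biUnion sawWords).filter (fun b => IsBridgeW b ∧
      xEnd b = (L : ℤ) + 1 ∧ wEnd b 1 = y₁ - y₀ ∧ ∀ i, |y₀ + traj b i 1| ≤ (X : ℤ)) with hT
  set P : List (List Step) → Prop := fun l => (∀ w ∈ l, IsIrrBridge w) ∧
      (l.map xEnd).sum = ((L + 1 : ℕ) : ℤ) ∧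
      (y₀ + wEnd l.flatten 1 = y₁ ∧ ∀ i, |y₀ + traj l.flatten i 1| ≤ (X : ℤ)) with hP
  have hLc : ((L + 1 : ℕ) : ℤ) = (L : ℤ) + 1 := by push_cast; ring
  -- `flatten` maps the chains into `T`
  have hmem : ∀ l : List (List Step), P l → l.flatten ∈ T := by
    rintro l ⟨hirr, hsum, hend, htube⟩
    have hs : IsSAW l.flatten :=
      isSAW_flatten (fun w hw => (hirr w hw).saw) fun w hw => (hirr w hw).bridge
    have hb : IsBridgeW l.flatten := isBridgeW_flatten fun w hw => (hirr w hw).bridge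
    have hx : xEnd l.flatten = (L : ℤ) + 1 := by rw [xEnd_flatten, hsum, hLc]
    have hlt := length_lt_of_tube hs hb hx htube
    exact mem_tubeWords.2 ⟨by omega, hs, hb, hx, by linarith, htube⟩
  -- and bijectively so (Kesten's factorisation)
  have hbij : Function.Bijective fun l : {l // P l} => (⟨l.1.flatten, hmem l.1 l.2⟩ : {b // b ∈ T}) := by
    constructor
    · intro l₁ l₂ h
      have h' : l₁.1.flatten = l₂.1.flatten := congrArg Subtype.val h
      exact Subtype.ext (slabOfChain_flatten_injective _ _ l₁.2.1 l₂.2.1 h')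
    · rintro ⟨b, hb⟩
      obtain ⟨-, hs, hbr, hx, hw, ht⟩ := mem_tubeWords.1 hb
      obtain ⟨l, hirr, hfl⟩ := exists_chain_eq_flatten b.length b le_rfl hs hbr
      refine ⟨⟨l, hirr, ?_, ?_, ?_⟩, Subtype.ext hfl⟩
      · rw [← xEnd_flatten, hfl, hx, hLc]
      · rw [hfl, hw]; ring
      · rw [hfl]; exact ht
  have h1 := (Equiv.ofBijective _ hbij).tsum_eq fun x : {b // b ∈ T} =>
    ENNReal.ofReal (criticalFugacity ^ x.1.length)
  have h2 : ∑' x : {b // b ∈ T}, ENNReal.ofReal (criticalFugacity ^ x.1.length) =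
      ∑ b ∈ T, ENNReal.ofReal (criticalFugacity ^ b.length) :=
    Finset.tsum_subtype T fun b => ENNReal.ofReal (criticalFugacity ^ b.length)
  rw [← h2, ← h1]
  refine tsum_congr fun l => ?_
  simp only [Equiv.ofBijective_apply, List.length_flatten]

/-- The slab partial sums are non-negative. [folklore] -/
theorem slab_nonneg (L X : ℕ) (y₀ y₁ : ℤ) (N : ℕ) :
    0 ≤ ∑ n ∈ Finset.range (N + 1), ∑ _ω ∈ (Zd.sawFun 2 n ![(L : ℤ), y₁ - y₀]).filter
        (fun ω => ∀ i ≤ n, (0 : ℤ) ≤ ω i 0 ∧ ω i 0 ≤ (L : ℤ) ∧ |y₀ + ω i 1| ≤ (X : ℤ)),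
        criticalFugacity ^ n :=
  Finset.sum_nonneg fun _ _ => Finset.sum_nonneg fun _ _ =>
    pow_nonneg StripMass.criticalFugacity_pos.le _

/-- The slab partial sums are monotone in the length cut-off `N`. [folklore] -/
theorem slab_mono (L X : ℕ) (y₀ y₁ : ℤ) {N N' : ℕ} (h : N ≤ N') :
    (∑ n ∈ Finset.range (N + 1), ∑ _ω ∈ (Zd.sawFun 2 n ![(L : ℤ), y₁ - y₀]).filter
        (fun ω => ∀ i ≤ n, (0 : ℤ) ≤ ω i 0 ∧ ω i 0 ≤ (L : ℤ) ∧ |y₀ + ω i 1| ≤ (X : ℤ)),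
        criticalFugacity ^ n) ≤
      ∑ n ∈ Finset.range (N' + 1), ∑ _ω ∈ (Zd.sawFun 2 n ![(L : ℤ), y₁ - y₀]).filter
        (fun ω => ∀ i ≤ n, (0 : ℤ) ≤ ω i 0 ∧ ω i 0 ≤ (L : ℤ) ∧ |y₀ + ω i 1| ≤ (X : ℤ)),
        criticalFugacity ^ n :=
  Finset.sum_le_sum_of_subset_of_nonneg (Finset.range_mono (by omega)) fun _ _ _ =>
    Finset.sum_nonneg fun _ _ => pow_nonneg StripMass.criticalFugacity_pos.le _

/-- **Chain mass = `x_c` · slab mass.** For `|y₀| ≤ X` and `N + 2 ≥ (L + 2)(2X + 1)`, the `x_c`-mass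
of the tube Kesten chains of span `L + 1` is `ofReal (x_c · slab partial sum up to N)`: both are sums
over the tube bridge words `b`, of `x_c ^ |b| = x_c · x_c ^ (|b| - 1)`. [cite: Kesten1963SAW, §4] -/
theorem chain_eq_ofReal_slab (L X : ℕ) (y₀ y₁ : ℤ) (hy₀ : |y₀| ≤ (X : ℤ)) (N : ℕ)
    (hN : (L + 2) * (2 * X + 1) ≤ N + 2) :
    (∑' l : {l : List (List Step) // (∀ w ∈ l, IsIrrBridge w) ∧
        (l.map xEnd).sum = ((L + 1 : ℕ) : ℤ) ∧
        (y₀ + wEnd l.flatten 1 = y₁ ∧ ∀ i, |y₀ + traj l.flatten i 1| ≤ (X : ℤ))},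
      ENNReal.ofReal (criticalFugacity ^ (l.1.map List.length).sum)) =
      ENNReal.ofReal (criticalFugacity * ∑ n ∈ Finset.range (N + 1),
        ∑ _ω ∈ (Zd.sawFun 2 n ![(L : ℤ), y₁ - y₀]).filter
          (fun ω => ∀ i ≤ n, (0 : ℤ) ≤ ω i 0 ∧ ω i 0 ≤ (L : ℤ) ∧ |y₀ + ω i 1| ≤ (X : ℤ)),
          criticalFugacity ^ n) := by
  have hxc := StripMass.criticalFugacity_pos
  rw [chain_tsum_eq L X y₀ y₁ N hN, slab_sum_eq L X y₀ y₁ hy₀ N, Finset.mul_sum,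
    ENNReal.ofReal_sum_of_nonneg fun b _ => mul_nonneg hxc.le (pow_nonneg hxc.le _)]
  refine Finset.sum_congr rfl fun b hb => ?_
  obtain ⟨-, -, -, hx, -⟩ := mem_tubeWords.1 hb
  have hne : b ≠ [] := by
    rintro rfl
    have h0 : xEnd ([] : List Step) = 0 := by simp [xEnd]
    rw [h0] at hx
    omega
  have h1 : 1 ≤ b.length := List.length_pos_iff.2 hne
  congr 1
  rw [← pow_succ', Nat.sub_add_cancel h1]

end SlabOfChain

/-! ### The stub -/

/-- **Stub B′p0 `stub_slabOfChain`** of the line `Sketch` of crux `ConfinementPositivity`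
(stmt-CriticalPhenomena-17587): the chain-level pinned tube statement `ChainPinnedTube` implies the
slab tube confinement `SlabTubeConfinement` (both written out over tree vocabulary).  Given `α`, take
the constant `c` of the hypothesis; given the data and `N`, put `N' = N + (L+2)(2V+1)`.  By
`SlabOfChain.chain_eq_ofReal_slab` (Kesten's factorisation of the bridge word `E :: wordOf n ω` of a
slab walk, and finiteness of the tube families) the chain masses for the tubes `V` and `W` are
`ofReal (x_c · slab_V(N'))` and `ofReal (x_c · slab_W(N'))`, so the hypothesis reads
`c · x_c · slab_V(N') ≤ x_c · slab_W(N')`; cancel `x_c > 0` and use monotonicity in `N`.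
[cite: Kesten1963SAW, §4] -/
theorem stub_slabOfChain :
    (∀ α : ℕ, 1 ≤ α → ∃ c : ℝ, 0 < c ∧ ∀ (L W V : ℕ) (y₀ y₁ : ℤ), 1 ≤ W → W ≤ V → L ≤ α * W →
      2 * |y₀| ≤ (W : ℤ) → 2 * |y₁| ≤ (W : ℤ) →
      ENNReal.ofReal c *
          (∑' l : {l : List (List Step) // (∀ w ∈ l, IsIrrBridge w) ∧ (l.map xEnd).sum = ((L + 1 : ℕ) : ℤ) ∧
              (y₀ + wEnd l.flatten 1 = y₁ ∧ ∀ i, |y₀ + traj l.flatten i 1| ≤ (V : ℤ))},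
            ENNReal.ofReal (criticalFugacity ^ (l.1.map List.length).sum)) ≤
        ∑' l : {l : List (List Step) // (∀ w ∈ l, IsIrrBridge w) ∧ (l.map xEnd).sum = ((L + 1 : ℕ) : ℤ) ∧
            (y₀ + wEnd l.flatten 1 = y₁ ∧ ∀ i, |y₀ + traj l.flatten i 1| ≤ (W : ℤ))},
          ENNReal.ofReal (criticalFugacity ^ (l.1.map List.length).sum)) →
    (∀ α : ℕ, 1 ≤ α → ∃ c : ℝ, 0 < c ∧ ∀ (L W V : ℕ) (y₀ y₁ : ℤ), 1 ≤ W → W ≤ V → L ≤ α * W →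
      2 * |y₀| ≤ (W : ℤ) → 2 * |y₁| ≤ (W : ℤ) → ∀ N : ℕ, ∃ N' : ℕ,
        c * (∑ n ∈ Finset.range (N + 1), ∑ _ω ∈ (Zd.sawFun 2 n ![(L : ℤ), y₁ - y₀]).filter
            (fun ω => ∀ i ≤ n, (0 : ℤ) ≤ ω i 0 ∧ ω i 0 ≤ (L : ℤ) ∧ |y₀ + ω i 1| ≤ (V : ℤ)), criticalFugacity ^ n) ≤
          (∑ n ∈ Finset.range (N' + 1), ∑ _ω ∈ (Zd.sawFun 2 n ![(L : ℤ), y₁ - y₀]).filter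
            (fun ω => ∀ i ≤ n, (0 : ℤ) ≤ ω i 0 ∧ ω i 0 ≤ (L : ℤ) ∧ |y₀ + ω i 1| ≤ (W : ℤ)), criticalFugacity ^ n)) := by
  intro H α hα
  obtain ⟨c, hc, H⟩ := H α hα
  refine ⟨c, hc, fun L W V y₀ y₁ hW hWV hL hy₀ hy₁ N => ?_⟩
  have hxc := StripMass.criticalFugacity_pos
  have hWV' : (W : ℤ) ≤ (V : ℤ) := by exact_mod_cast hWV
  have ha := abs_nonneg y₀
  have hy₀W : |y₀| ≤ (W : ℤ) := by linarith
  have hy₀V : |y₀| ≤ (V : ℤ) := by linarith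
  refine ⟨N + (L + 2) * (2 * V + 1), ?_⟩
  have hMV : (L + 2) * (2 * V + 1) ≤ N + (L + 2) * (2 * V + 1) + 2 :=
    (Nat.le_add_left _ _).trans (Nat.le_add_right _ _)
  have hMW : (L + 2) * (2 * W + 1) ≤ N + (L + 2) * (2 * V + 1) + 2 :=
    (Nat.mul_le_mul_left _ (by omega)).trans hMV
  have key := H L W V y₀ y₁ hW hWV hL hy₀ hy₁
  rw [SlabOfChain.chain_eq_ofReal_slab L V y₀ y₁ hy₀V _ hMV,
    SlabOfChain.chain_eq_ofReal_slab L W y₀ y₁ hy₀W _ hMW, ← ENNReal.ofReal_mul hc.le,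
    ENNReal.ofReal_le_ofReal_iff (mul_nonneg hxc.le (SlabOfChain.slab_nonneg L W y₀ y₁ _)),
    mul_left_comm] at key
  exact (mul_le_mul_of_nonneg_left (SlabOfChain.slab_mono L V y₀ y₁ (Nat.le_add_right N _)) hc.le).trans
    (le_of_mul_le_mul_left key hxc)

end Summit.CriticalPhenomena.SAWScalingLimit.Theorems

end
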